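import Literature.Analysis.FluidPDE.KatoWeakForm
import Literature.Analysis.FluidPDE.DistributionalToWeak
import HarnessLib

/-!
# Kato solutions are weak solutions with datum (mild ⇒ Leray's weak form up to `t = 0`)

Analysis/FluidPDE proof file (theorems only, everything proved) on the discharge path of the
named fact `Literature.Analysis.FluidPDE.ess_kato_L3_local` (`NSLerayHopfProofs.lean`;
Escauriaza–Seregin–Šverák 2003, Thm. 7.4 with Remark 7.5: Kato's local solution "is in fact the
weak Leray–Hopf solution"). The first clause of the tree's `Fluid.IsLerayHopfOn` is the
pressure-free weak formulation **with datum** `Fluid.IsWeakNSSolutionOn T ν 0 u₀ u` (Leray 1934,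
(17): tests supported in `t < T`, datum term `∫⟪u₀, ψ(0)⟫`), whereas the tree proves for Kato
solutions (`IsKatoSolutionOn`: duality-form mild solution in `C([0,T); L³)`, Kato 1984) the weak
identity only for tests supported in the **open** slab `(0, T) × ℝ³`
(`IsKatoSolutionOn.integral_weakForm_eq_zero`, `KatoWeakForm.lean`; Fabes–Jones–Rivière 1972,
Thm. 2.1 (ii) ⇒ (i)). This file supplies the passage to `t = 0`:

* `weakIdentity_datum_of_open_slab` — the **cut-off argument** for the pressure-free form: if the
  identity holds for all divergence-free tests on the open slab, `u, ‖u‖²` are integrable on the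
  finite cylinders `(0,T) × K`, and `u(t) → u₀` in `L²_loc` as `t → 0⁺`, then the identity with
  datum holds for every divergence-free test on `(-∞, T) × E` (test with `η_δ(t)ψ`, `η_δ` a smooth
  monotone cut-off vanishing near `t = 0`, and let `δ → 0`; Robinson–Rodrigo–Sadowski 2016, §3.1,
  p. 58). The proof is that of the tree's `weakIdentity_datum_of_distributional`
  (`DistributionalToWeak.lean`, pressure-explicit form) with the pressure term absent; all its
  lemmas (`exists_smooth_time_cutoff`, `IsSpaceTimeTestOn.cutoff`, `timeDeriv_cutoff`,
  `integrable_slab_inner`, `exists_ae_abs_pairing_sub_datum_le`, …) are reused.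
* (a Kato solution on `[0, T₀)` is square integrable on the cylinders `(0,T) × K`, `T < T₀`,
  and attains its datum in `L²_loc` — from `C([0,T₀); L³)` — by the tree's
  `IsKatoSolutionOn.sqIntegrable_slab` and `IsKatoSolutionOn.initial_slab`,
  `KatoLocalLeraySlab.lean`; the Hölder tool `lintegral_sq_le_of_eLpNorm_three` is kept here.)
* `IsKatoSolutionOn.isWeakNSSolutionOn` — **a Kato solution on `[0, T₀)`, `ν > 0`, is a weak
  solution with datum `u₀` on `[0, T)` for every `0 < T < T₀`** (`Fluid.IsWeakNSSolutionOn T ν 0 u₀ u`).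

## Mathlib / tree search

Tree: `IsKatoSolutionOn.integral_weakForm_eq_zero_of_le`, `IsKatoSolutionOn.memLp_three_strip`
(`KatoWeakForm`), `IsKatoSolutionOn.sqIntegrable_slab`, `IsKatoSolutionOn.initial_slab`
(`KatoLocalLeraySlab`), the cut-off toolkit of `DistributionalToWeak` (listed above),
`IsKatoSolutionOn.mono/continuousInLpOn/memLp_initial` (`KatoMaximalTime`); no datum form of the
weak identity for mild/Kato solutions existed (the FJR fact `IsMildNSSolutionOn.isWeakNSSolutionOn`
of `MildSolution.lean` is an undischarged named fact and is not used here). Mathlib: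
`MemLp.mono_exponent`, `eLpNorm_le_eLpNorm_mul_rpow_measure_univ`, `nhdsWithin_Ioo_eq_nhdsGT`,
`tendsto_integral_of_dominated_convergence`.

## References

* E. B. Fabes, B. F. Jones, N. M. Rivière, Arch. Rational Mech. Anal. 45 (1972), Thm. 2.1. [FabesJonesRiviere1972]
* J. C. Robinson, J. L. Rodrigo, W. Sadowski, *The three-dimensional Navier–Stokes equations*
  (CUP 2016), §3.1, p. 58, (3.1). [RobinsonRodrigoSadowski2016]
* L. Escauriaza, G. Seregin, V. Šverák, Russ. Math. Surveys 58:2 (2003), Remark 7.5. [EscauriazaSereginSverak2003]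
* T. Kato, Math. Z. 187 (1984), Thm. 1. [Kato1984]
-/

noncomputable section

open MeasureTheory TopologicalSpace Set Function Filter Topology InnerProductSpace Metric
open scoped RealInnerProductSpace ENNReal NNReal Laplacian

namespace Literature.Analysis.FluidPDE

/-! ### The cut-off argument, pressure-free form -/

section Cutoff

variable {E : Type*} [NormedAddCommGroup E] [InnerProductSpace ℝ E] [FiniteDimensional ℝ E]
  [MeasurableSpace E] [BorelSpace E]
variable {T ν : ℝ} {u : ℝ → E → E} {u₀ : E → E}

/-- **The cut-off argument (pressure-free form).** Let `u` satisfy the pressure-free weak identity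
against all divergence-free test fields on the open slab `(0,T) × E`, with `u, ‖u‖²` integrable on
the finite cylinders `(0,T) × K`, a.e. slice of `u` measurable and locally `L²`, `u₀` measurable,
and `u(t) → u₀` in `L²_loc` as `t → 0⁺`. Then for every test field `ψ` on `(-∞, T) × E` with
divergence-free slices
`∫₀ᵀ ∫ (⟪u, ∂ₜψ⟫ + ⟪u, (u·∇)ψ⟫ + ν ⟪u, Δψ⟫) + ∫ ⟪u₀, ψ(0)⟫ = 0`:
test with `η_δ(t) ψ(t,x)` (again divergence free) and let `δ → 0` (Robinson–Rodrigo–Sadowski 2016,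
§3.1, p. 58; the tree's `weakIdentity_datum_of_distributional` without the pressure term).
[cite: RobinsonRodrigoSadowski2016, §3.1 p. 58 (3.1)] -/
theorem weakIdentity_datum_of_open_slab (hT : 0 < T)
    (hUK : ∀ K : Set E, IsCompact K → IntegrableOn (uncurry u) (Ioo 0 T ×ˢ K) volume ∧
      IntegrableOn (fun z => ‖uncurry u z‖ ^ 2) (Ioo 0 T ×ˢ K) volume)
    (hmom : ∀ ψ : ℝ → E → E, IsSpaceTimeTestOn (slab E (Ioo 0 T) isOpen_Ioo) ψ →
      (∀ t, VectorCalculus.IsDivFree (ψ t)) →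
      ∫ t in Ioo 0 T, ∫ x, (⟪u t x, timeDeriv ψ t x⟫ + ⟪u t x, convect (u t) (ψ t) x⟫ +
        ν * ⟪u t x, Δ (ψ t) x⟫) = 0)
    (hgood : ∀ᵐ t ∂((volume : Measure ℝ).restrict (Ioo 0 T)),
      AEStronglyMeasurable (u t) (volume : Measure E) ∧
        ∀ n : ℕ, ∫⁻ x in closedBall (0 : E) n, ‖u t x‖ₑ ^ 2 < ∞)
    (hm₀ : AEStronglyMeasurable u₀ (volume : Measure E))
    (h₀ : ∀ K : Set E, IsCompact K →
      Tendsto (fun t => ∫⁻ x in K, ‖u t x - u₀ x‖ₑ ^ 2) (𝓝[>] 0) (𝓝 0))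
    {ψ : ℝ → E → E} (hψ : IsSpaceTimeTestOn (slab E (Iio T) isOpen_Iio) ψ)
    (hdiv : ∀ t, VectorCalculus.IsDivFree (ψ t)) :
    (∫ t in Ioo 0 T, ∫ x, (⟪u t x, timeDeriv ψ t x⟫ + ⟪u t x, convect (u t) (ψ t) x⟫ +
        ν * ⟪u t x, Δ (ψ t) x⟫)) + ∫ x, ⟪u₀ x, ψ 0 x⟫ = 0 := by
  -- the compact `x`-shadow of `ψ`, enlarged to a closed ball `K`
  obtain ⟨K₀, hK₀, hK₀t⟩ := hψ.exists_compact_slice_subset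
  obtain ⟨r, hr⟩ := hK₀.isBounded.subset_closedBall (0 : E)
  set n : ℕ := ⌈r⌉₊ with hn
  set K : Set E := closedBall (0 : E) n with hK_def
  have hK : IsCompact K := isCompact_closedBall _ _
  have hKt : ∀ t, tsupport (ψ t) ⊆ K := fun t =>
    (hK₀t t).trans (hr.trans (closedBall_subset_closedBall (Nat.le_ceil r)))
  have hψ0 : ∀ t x, x ∉ K → ψ t x = 0 := fun t x hx =>
    image_eq_zero_of_notMem_tsupport fun h' => hx (hKt t h')
  -- regularity of the test-field ingredients as functions on `ℝ × E`
  have cψ : Continuous (uncurry ψ) := hψ.contDiff.continuous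
  have cψ' : Continuous (uncurry (timeDeriv ψ)) := hψ.continuous_timeDeriv
  have cD : Continuous fun z : ℝ × E => fderiv ℝ (ψ z.1) z.2 := by
    have h := ((hψ.isSmoothSpaceTimeOn univ).fderiv_slice uniqueDiffOn_univ).continuousOn
    rw [univ_prod_univ, continuousOn_univ] at h
    exact h
  have cL : Continuous fun z : ℝ × E => Δ (ψ z.1) z.2 := by
    have h := ((hψ.isSmoothSpaceTimeOn univ).laplacian uniqueDiffOn_univ).continuousOn
    rw [univ_prod_univ, continuousOn_univ] at h
    exact h
  have hψd : ∀ t, Differentiable ℝ (ψ t) := fun t =>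
    (hψ.contDiff_slice t).differentiable (by simp)
  have hψ2 : ∀ t, ContDiff ℝ 2 (ψ t) := fun t => contDiff_infty.1 (hψ.contDiff_slice t) 2
  have hD0 : ∀ t x, x ∉ K → fderiv ℝ (ψ t) x = 0 := fun t x hx =>
    fderiv_of_notMem_tsupport ℝ fun h => hx (hKt t h)
  have hL0 : ∀ t x, x ∉ K → Δ (ψ t) x = 0 := fun t x hx =>
    laplacian_eq_zero_of_notMem_tsupport fun h => hx (hKt t h)
  have hψ'0 : ∀ t x, x ∉ K → timeDeriv ψ t x = 0 := fun t x hx =>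
    timeDeriv_eq_zero_of_forall (fun s => hψ0 s x hx) t
  -- integrability on the slab
  obtain ⟨hUK1, hUK2⟩ := hUK K hK
  have iA : Integrable (fun z : ℝ × E => ⟪u z.1 z.2, timeDeriv ψ z.1 z.2⟫)
      (((volume : Measure ℝ).restrict (Ioo 0 T)).prod (volume : Measure E)) :=
    integrable_slab_inner hK hUK1 cψ' hψ'0
  have iB : Integrable (fun z : ℝ × E => ⟪u z.1 z.2, convect (u z.1) (ψ z.1) z.2⟫)
      (((volume : Measure ℝ).restrict (Ioo 0 T)).prod (volume : Measure E)) :=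
    integrable_slab_inner_clm_apply hK hUK1 hUK2 cD hD0
  have iC : Integrable (fun z : ℝ × E => ⟪u z.1 z.2, Δ (ψ z.1) z.2⟫)
      (((volume : Measure ℝ).restrict (Ioo 0 T)).prod (volume : Measure E)) :=
    integrable_slab_inner hK hUK1 cL hL0
  have iU : Integrable (fun z : ℝ × E => ⟪u z.1 z.2, ψ z.1 z.2⟫)
      (((volume : Measure ℝ).restrict (Ioo 0 T)).prod (volume : Measure E)) :=
    integrable_slab_inner hK hUK1 cψ hψ0
  set Φ : ℝ × E → ℝ := fun z => ⟪u z.1 z.2, timeDeriv ψ z.1 z.2⟫ +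
    ⟪u z.1 z.2, convect (u z.1) (ψ z.1) z.2⟫ + ν * ⟪u z.1 z.2, Δ (ψ z.1) z.2⟫ with hΦ
  have iΦ : Integrable Φ (((volume : Measure ℝ).restrict (Ioo 0 T)).prod (volume : Measure E)) :=
    (iA.add iB).add (iC.const_mul ν)
  -- the pairing `U(t) = ⟨u(t), ψ(t)⟩` and its a.e. limit at `0⁺`
  set U : ℝ → ℝ := fun t => ∫ x, ⟪u t x, ψ t x⟫ with hU_def
  set L : ℝ := ∫ x, ⟪u₀ x, ψ 0 x⟫ with hL_def
  have hUint : IntegrableOn U (Ioo 0 T) := iU.integral_prod_left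
  have hgoodK : ∀ᵐ t ∂((volume : Measure ℝ).restrict (Ioo 0 T)),
      AEStronglyMeasurable (u t) (volume : Measure E) ∧ ∫⁻ x in K, ‖u t x‖ₑ ^ 2 < ∞ := by
    filter_upwards [hgood] with t ht
    exact ⟨ht.1, ht.2 n⟩
  have hu₀ : ∫⁻ x in K, ‖u₀ x‖ₑ ^ 2 < ∞ := lintegral_datum_sq_lt_top hT hgoodK hm₀ (h₀ K hK)
  have hlim : ∀ ε > 0, ∃ τ > 0, ∀ᵐ t ∂((volume : Measure ℝ).restrict (Ioo 0 τ)), |U t - L| ≤ ε :=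
    fun ε hε => exists_ae_abs_pairing_sub_datum_le hT hK hgoodK hm₀ hu₀ (h₀ K hK) cψ
      hψ.hasCompactSupport hψ0 hε
  -- the cut-offs `η k` with derivatives `ρ k`, at scale `δ k = T / (6 (k + 1))`
  set δ : ℕ → ℝ := fun k => T / (6 * ((k : ℝ) + 1)) with hδ
  have hδ0 : ∀ k, 0 < δ k := fun k => by positivity
  have hδT : ∀ k, 3 * δ k ≤ T := fun k => by
    have hk : (0 : ℝ) ≤ k := Nat.cast_nonneg k
    have h1 : δ k ≤ T / 6 := by
      show T / (6 * ((k : ℝ) + 1)) ≤ T / 6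
      exact div_le_div_of_nonneg_left hT.le (by norm_num) (by nlinarith)
    linarith
  have hδlim : Tendsto δ atTop (𝓝 0) := by
    have h1 : Tendsto (fun k : ℕ => (k : ℝ) + 1) atTop atTop :=
      tendsto_atTop_add_const_right _ 1 tendsto_natCast_atTop_atTop
    have h2 : Tendsto (fun k : ℕ => 6 * ((k : ℝ) + 1)) atTop atTop :=
      h1.const_mul_atTop (by norm_num)
    exact tendsto_const_nhds.div_atTop h2
  obtain hcut : ∀ k, ∃ η ρ : ℝ → ℝ, ContDiff ℝ (⊤ : ℕ∞) η ∧ Continuous ρ ∧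
      (∀ s, HasDerivAt η (ρ s) s) ∧ (∀ s, s ≤ δ k → η s = 0) ∧ (∀ s, 3 * δ k ≤ s → η s = 1) ∧
      (∀ s, η s ∈ Icc (0 : ℝ) 1) ∧ (∀ s, 0 ≤ ρ s) ∧ (∀ s, s ∉ Ioo (δ k) (3 * δ k) → ρ s = 0) ∧
      ∫ s, ρ s = 1 := fun k => exists_smooth_time_cutoff (hδ0 k)
  choose η ρ hηs hρc hηρ hη0 hη1 hη01 hρ0 hρsupp hρ1 using hcut
  have hηabs : ∀ k s, |η k s| ≤ 1 := fun k s => by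
    rw [abs_le]
    exact ⟨by linarith [(hη01 k s).1], (hη01 k s).2⟩
  have hρC : ∀ k, ∃ C, 0 ≤ C ∧ ∀ s, |ρ k s| ≤ C := fun k =>
    exists_abs_le_of_eq_zero_off_Ioo (hρc k) (hρsupp k)
  -- Step 1: the tested identity for each `k`
  have hAB : ∀ k, (∫ z, η k z.1 * Φ z ∂(((volume : Measure ℝ).restrict (Ioo 0 T)).prod
      (volume : Measure E))) + ∫ t in Ioo 0 T, ρ k t * U t = 0 := by
    intro k
    obtain ⟨C, -, hC⟩ := hρC k
    have hψk : IsSpaceTimeTestOn (slab E (Ioo 0 T) isOpen_Ioo) (fun s x => η k s • ψ s x) :=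
      hψ.cutoff (hδ0 k) (hηs k) (hη0 k)
    have hdivk : ∀ t, VectorCalculus.IsDivFree (fun x => η k t • ψ t x) := fun t x => by
      rw [divergence_fun_const_smul (hψd t x), hdiv t x, mul_zero]
    have key := hmom _ hψk hdivk
    have iρU : Integrable (fun z : ℝ × E => ρ k z.1 * ⟪u z.1 z.2, ψ z.1 z.2⟫)
        (((volume : Measure ℝ).restrict (Ioo 0 T)).prod (volume : Measure E)) :=
      integrable_time_mul iU (hρc k) hC
    have iηΦ : Integrable (fun z : ℝ × E => η k z.1 * Φ z)
        (((volume : Measure ℝ).restrict (Ioo 0 T)).prod (volume : Measure E)) :=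
      integrable_time_mul iΦ (hηs k).continuous (hηabs k)
    -- the pointwise algebra of the cut-off test
    have hptw : ∀ t x, ⟪u t x, timeDeriv (fun s x => η k s • ψ s x) t x⟫ +
        ⟪u t x, convect (u t) (fun x => η k t • ψ t x) x⟫ +
        ν * ⟪u t x, Δ (fun x => η k t • ψ t x) x⟫ =
        ρ k t * ⟪u t x, ψ t x⟫ + η k t * Φ (t, x) := by
      intro t x
      rw [hΦ]
      dsimp only
      rw [timeDeriv_cutoff (hηρ k) hψ.hasDerivAt_time, convect_fun_const_smul _ (hψd t x),
        laplacian_fun_const_smul (hψ2 t)]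
      simp only [inner_add_right, real_inner_smul_right]
      ring
    have key' : ∫ t in Ioo 0 T, ∫ x, (ρ k t * ⟪u t x, ψ t x⟫ + η k t * Φ (t, x)) = 0 := by
      refine Eq.trans (setIntegral_congr_fun measurableSet_Ioo fun t _ => ?_) key
      exact integral_congr_ae (Eventually.of_forall fun x => (hptw t x).symm)
    have hprod := integral_prod (μ := (volume : Measure ℝ).restrict (Ioo 0 T))
      (ν := (volume : Measure E)) _ (iρU.add iηΦ)
    simp only [Pi.add_apply] at hprod
    rw [← hprod, integral_add iρU iηΦ, integral_prod _ iρU] at key'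
    simp only [integral_const_mul] at key'
    rw [add_comm]
    exact key'
  -- Step 2: the limits `k → ∞`
  have hA : Tendsto (fun k => ∫ z, η k z.1 * Φ z ∂(((volume : Measure ℝ).restrict (Ioo 0 T)).prod
      (volume : Measure E))) atTop
      (𝓝 (∫ z, Φ z ∂(((volume : Measure ℝ).restrict (Ioo 0 T)).prod (volume : Measure E)))) := by
    refine tendsto_integral_of_dominated_convergence (fun z => ‖Φ z‖)
      (fun k => (integrable_time_mul iΦ (hηs k).continuous (hηabs k)).aestronglyMeasurable)
      iΦ.norm (fun k => Eventually.of_forall fun z => ?_) ?_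
    · rw [norm_mul, Real.norm_eq_abs]
      exact mul_le_of_le_one_left (norm_nonneg _) (hηabs k z.1)
    · have hmem : ∀ᵐ z ∂(((volume : Measure ℝ).restrict (Ioo 0 T)).prod (volume : Measure E)),
          z ∈ Ioo 0 T ×ˢ (univ : Set E) := by
        rw [← volume_restrict_slab_eq]
        exact ae_restrict_mem (measurableSet_Ioo.prod MeasurableSet.univ)
      filter_upwards [hmem] with z hz
      have hz1 : 0 < z.1 := hz.1.1
      have h3 : Tendsto (fun k => 3 * δ k) atTop (𝓝 0) := by
        simpa using hδlim.const_mul 3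
      have hev : ∀ᶠ k in atTop, 3 * δ k < z.1 := (tendsto_order.1 h3).2 _ hz1
      refine (tendsto_const_nhds (x := Φ z)).congr' ?_
      filter_upwards [hev] with k hk
      rw [hη1 k z.1 hk.le, one_mul]
  have hB : Tendsto (fun k => ∫ t in Ioo 0 T, ρ k t * U t) atTop (𝓝 L) :=
    tendsto_setIntegral_mul_of_ae_tendsto hUint hlim hδlim hδ0 hδT hρc hρ0 hρsupp hρ1
  have hsum : (∫ z, Φ z ∂(((volume : Measure ℝ).restrict (Ioo 0 T)).prod (volume : Measure E))) +
      L = 0 :=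
    tendsto_nhds_unique (hA.add hB) (by simpa only [hAB] using tendsto_const_nhds)
  rw [integral_prod _ iΦ] at hsum
  exact hsum

end Cutoff

/-! ### Kato solutions: an `L³ ⊂ L²(K)` tool and the weak formulation with datum -/

section Kato


variable {T₀ T ν : ℝ} {u₀ : (EuclideanSpace ℝ (Fin 3)) → (EuclideanSpace ℝ (Fin 3))} {u : ℝ → (EuclideanSpace ℝ (Fin 3)) → (EuclideanSpace ℝ (Fin 3))}

/-- On a compact set, the squared `L²` size is controlled by the `L³` norm:
`∫_K ‖v‖² ≤ ‖v‖₃² |K|^{1/3}` (in the form `(‖v‖_{L²(K)})² ≤ (‖v‖_{L³} |K|^{1/6})²`). [folklore] -/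
theorem lintegral_sq_le_of_eLpNorm_three (v : (EuclideanSpace ℝ (Fin 3)) → (EuclideanSpace ℝ (Fin 3))) (hv : AEStronglyMeasurable v volume)
    {K : Set (EuclideanSpace ℝ (Fin 3))} (hK : IsCompact K) :
    ∫⁻ x in K, ‖v x‖ₑ ^ 2 ≤ (eLpNorm v 3 volume * volume K ^ (1 / (2 : ℝ) - 1 / 3)) ^ 2 := by
  have hKfin : volume K < ∞ := hK.measure_lt_top
  have h := eLpNorm_le_eLpNorm_mul_rpow_measure_univ (μ := (volume : Measure (EuclideanSpace ℝ (Fin 3))).restrict K)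
    (p := 2) (q := 3) (by norm_num) (hv.restrict)
  rw [Measure.restrict_apply_univ] at h
  have h2 : ∫⁻ x in K, ‖v x‖ₑ ^ 2 = eLpNorm v 2 ((volume : Measure (EuclideanSpace ℝ (Fin 3))).restrict K) ^ 2 := by
    have := eLpNorm_natCast_pow_eq_lintegral ((volume : Measure (EuclideanSpace ℝ (Fin 3))).restrict K) v (n := 2) two_ne_zero
    simp only [Nat.cast_ofNat] at this
    exact this.symm
  rw [h2]
  simp only [ENNReal.toReal_ofNat] at h
  gcongr
  exact h.trans (mul_le_mul' (eLpNorm_mono_measure v Measure.restrict_le_self) le_rfl)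

/-- **A Kato solution is a weak solution with datum** (Fabes–Jones–Rivière 1972, Thm. 2.1
(ii) ⇒ (i), up to the initial time; the first clause of "u is in fact the weak Leray–Hopf
solution", ESS 2003, Remark 7.5): for `ν > 0`, a Kato solution on `[0, T₀)` and `0 < T < T₀`,
`Fluid.IsWeakNSSolutionOn T ν 0 u₀ u` — measurability on the slab, square integrability on the
finite cylinders, weak divergence-freeness of every slice, and Leray's identity with datum for
every divergence-free test supported in `t < T` (open-slab identity of `KatoWeakForm` + the
cut-off argument `weakIdentity_datum_of_open_slab`). [cite: FabesJonesRiviere1972, Thm. 2.1] -/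
theorem IsKatoSolutionOn.isWeakNSSolutionOn (hν : 0 < ν) (hu : IsKatoSolutionOn T₀ ν u₀ u)
    (hT : T < T₀) (hT0 : 0 < T) : IsWeakNSSolutionOn T ν 0 u₀ u := by
  have hT₀ : 0 < T₀ := hT0.trans hT
  have huT : IsKatoSolutionOn T ν u₀ u := hu.mono hT.le
  have hmeas := huT.aestronglyMeasurable
  have hsq : ∀ K : Set (EuclideanSpace ℝ (Fin 3)), IsCompact K → ∫⁻ z in Ioo 0 T ×ˢ K, ‖uncurry u z‖ₑ ^ 2 < ∞ :=
    fun K hK => hu.sqIntegrable_slab hT K hK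
  refine ⟨hmeas, hsq, ?_, fun ψ hψ hdiv => ?_⟩
  · exact (ae_restrict_iff' measurableSet_Ioo).2 (Eventually.of_forall fun t ht =>
      hu.mild.1 t ⟨ht.1.le, ht.2.trans hT⟩)
  · have hUK : ∀ K : Set (EuclideanSpace ℝ (Fin 3)), IsCompact K → IntegrableOn (uncurry u) (Ioo 0 T ×ˢ K) volume ∧
        IntegrableOn (fun z => ‖uncurry u z‖ ^ 2) (Ioo 0 T ×ˢ K) volume := fun K hK =>
      integrableOn_cylinder_of_lintegral_sq_slab hmeas hsq hK
    have hgood := ae_slice_aestronglyMeasurable_and_lintegral_ball_lt_top hmeas hsq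
    have hm₀ : AEStronglyMeasurable u₀ (volume : Measure (EuclideanSpace ℝ (Fin 3))) := (hu.memLp_initial hT₀).1
    have h₀ : ∀ K : Set (EuclideanSpace ℝ (Fin 3)), IsCompact K →
        Tendsto (fun t => ∫⁻ x in K, ‖u t x - u₀ x‖ₑ ^ 2) (𝓝[>] 0) (𝓝 0) := fun K hK =>
      hu.initial_slab hT₀ K hK
    have hmom : ∀ φ : ℝ → (EuclideanSpace ℝ (Fin 3)) → (EuclideanSpace ℝ (Fin 3)), IsSpaceTimeTestOn (slab (EuclideanSpace ℝ (Fin 3)) (Ioo 0 T) isOpen_Ioo) φ →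
        (∀ t, VectorCalculus.IsDivFree (φ t)) →
        ∫ t in Ioo 0 T, ∫ x, (⟪u t x, timeDeriv φ t x⟫ + ⟪u t x, convect (u t) (φ t) x⟫ +
          ν * ⟪u t x, Δ (φ t) x⟫) = 0 := fun φ hφ hφdiv =>
      hu.integral_weakForm_eq_zero_of_le hν hT.le hφ hφdiv
    have key := weakIdentity_datum_of_open_slab hT0 hUK hmom hgood hm₀ h₀ hψ hdiv
    simpa only [Pi.zero_apply, inner_zero_left, add_zero] using key

end Kato

end Literature.Analysis.FluidPDE
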